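import Summits.CriticalPhenomena.CardyFormulaZ2.Theses.CardyBondTriangular
import Summits.CriticalPhenomena.CardyFormulaZ2.Theses.CardyIsoradial

/-!
# Birth skeleton (BC3) — crux `DiscretisationBridge` (stmt-CriticalPhenomena-0787)

Route `route-CriticalPhenomena-CardyBondTriangular` (item shared verbatim with CardyIsoradial,
CardyDiluteOrbit, CardyRetileGlue, CardySectorGap, CardyFlipRusso), sub-problem `CardyFormulaZ2`.

**Crux (fixed, route decl).** For every conformal rectangle `R`: Cardy for the crude embedded
crossing event `embDomainCrossing squareLatticeEmbedding.z R.carrier δ (R.arc 0) (R.arc 2)` under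
`P_{1/2}` on `ℤ²` implies Cardy for G02's `bondDomainCrossingProb R`.

**Line: squeeze on the common vertex set.** `squareLatticeEmbedding.z x = √2 · x`, so at crude
mesh `δ/√2` the rescaled vertices `(δ/√2)·√2·x = δ·x = meshPoint δ x` are exactly G02's mesh
points: both events live on the same configuration space `BondConfig (Site 2)` and the same
embedded vertex set `Ω ∩ δℤ²`. They differ only in (i) component selection (`meshDomain` = largest
component of the mesh graph vs. any vertices in `Ω`), (ii) the edge rule (`meshGraph`: closed
segment inside `closure Ω` vs. any `ℤ²` edge between points of `Ω`) and (iii) the endpoint rule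
(`discreteArc`: discrete-boundary vertices closest to the arc vs. `infDist ≤ 2·(δ/√2) = √2·δ`).
The crux then follows from three one-sided comparisons by an `ε/3` squeeze:

* `stub_discrete_le_crude` — deterministic, eventwise inclusion G02 ⊆ crude (size M): a
  `discreteDomainGraph` path is an open `ℤ²` path with all vertices in `Ω`, and a vertex of a
  discrete arc is within `δ ≤ √2·δ` of the continuous arc (a vertex of `meshBoundary` is within
  `δ` of `frontier Ω` by maximality of its component; the `discreteArc` distance comparison then
  puts a nearest boundary point on the arc). Holds for every `δ > 0`.
* `stub_crude_le_domainPath` — re-routing INTO `Ω_δ` (size L): for every `ε > 0`, eventually as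
  `δ → 0⁺`, an open crude crossing can be replaced, outside an event of probability `≤ ε`, by an
  open path of `Ω_δ = discreteDomainGraph` (largest component, closed-segment edges) between the
  same `√2·δ`-neighbourhoods of the arcs. Inputs: Jordan domains are uniformly locally connected
  (Newman 1951, Ch. VI), so pockets off the largest component and detours around sub-mesh exterior
  filaments have diameter `o(1)` (tree: `exists_forall_mem_meshDomain_and_reachable`, bulk ⊆
  `meshDomain`); RSW circuits in boundary annuli (`rsw_half_holds`,
  `Grimmett1999_openCircuitAround_half_holds`) pay for the local re-routing.
* `stub_domainPath_le_discrete` — arc attachment (size L): for every `ε > 0`, eventually, an open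
  `Ω_δ`-path between the `√2·δ`-neighbourhoods of `(ab)` and `(cd)` can be extended inside `Ω_δ`
  to the discrete arcs `(ab)_δ`, `(cd)_δ` outside an event of probability `≤ ε` (landing near the
  marked points costs `(ρ/r)^α` by annulus circuits; away from them, boundary RSW; Bollobás–Riordan
  2006, Ch. 7, remark p. 195 and end of proof of Thm 2, p. 202, there for site-𝕋).
* `DiscretisationBridge_of` — real proof (no sorry): reparametrise the hypothesis along `δ ↦ δ/√2`
  (`𝓝[>] 0 → 𝓝[>] 0`) and squeeze; concludes the route decl
  `…Theses.CardyBondTriangular.DiscretisationBridge` BY NAME from the three stub statements.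
* `DiscretisationBridge_proof` / `DiscretisationBridge_skeleton` — the registered
  skeleton shape (`ledger skeleton check`): hypothesis-free theorems concluding the shared item's
  decl in its primary route file (`…Theses.CardyIsoradial.DiscretisationBridge`, the checker's
  default) and in this route's file, by applying `DiscretisationBridge_of` to the three sorried stubs
  (sorry sits ONLY inside `stub_*`; the two route decls have the identical body, item
  stmt-CriticalPhenomena-0787 is shared verbatim by six routes).

Honest risk (inherited from the crux, recorded on the item): all three stubs range over EVERY
Jordan rectangle; for boundaries of positive area the union bounds behind the two probabilistic
stubs are not in print.
-/

namespace Summit.CriticalPhenomena.CardyFormulaZ2.Cruxes.DiscretisationBridge.Birth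

open Filter Topology

/-- **Stub 1 (deterministic inclusion G02 ⊆ crude).** For every conformal rectangle and every
mesh `δ > 0`, G02's crossing probability at mesh `δ` is at most the crude embedded crossing
probability at crude mesh `δ/√2` (same vertex positions `δℤ²`): every open `Ω_δ`-path from
`(ab)_δ` to `(cd)_δ` is an open `ℤ²`-path with vertices in `Ω` whose endpoints are within
`δ ≤ √2·δ = 2·(δ/√2)` of the continuous arcs. -/
theorem stub_discrete_le_crude :
    ∀ (R : Literature.Probability.RandomPlanarGeometry.ConformalRectangle) (δ : ℝ), 0 < δ →
      Literature.Probability.Percolation.bondDomainCrossingProb R δ ≤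
        (Literature.Probability.Percolation.bondPercolation
            (Literature.Probability.LatticeModels.zdGraph 2)
            Literature.Probability.Percolation.half).real
          (Literature.Probability.Percolation.embDomainCrossing
            Literature.Probability.LatticeModels.squareLatticeEmbedding.z R.carrier
            (δ / Real.sqrt 2) (R.arc 0) (R.arc 2)) := by
  sorry

/-- **Stub 2 (re-routing into `Ω_δ`).** For every conformal rectangle and `ε > 0`, eventually as
`δ → 0⁺`: the crude embedded crossing probability at crude mesh `δ/√2` exceeds by at most `ε` the
probability of an open path of `Ω_δ = discreteDomainGraph R.carrier δ` (largest mesh component,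
closed-segment edges) joining a vertex of `Ω_δ` within `√2·δ` of `(ab)` to a vertex of `Ω_δ`
within `√2·δ` of `(cd)`. Content: pockets and sub-mesh exterior filaments of a Jordan domain have
vanishing diameter (uniform local connectedness) and boundary RSW re-routes around them. -/
theorem stub_crude_le_domainPath :
    ∀ (R : Literature.Probability.RandomPlanarGeometry.ConformalRectangle) (ε : ℝ), 0 < ε →
      ∀ᶠ δ in 𝓝[>] (0 : ℝ),
        (Literature.Probability.Percolation.bondPercolation
            (Literature.Probability.LatticeModels.zdGraph 2)
            Literature.Probability.Percolation.half).real
          (Literature.Probability.Percolation.embDomainCrossing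
            Literature.Probability.LatticeModels.squareLatticeEmbedding.z R.carrier
            (δ / Real.sqrt 2) (R.arc 0) (R.arc 2)) ≤
        (Literature.Probability.Percolation.bondPercolation
            (Literature.Probability.LatticeModels.zdGraph 2)
            Literature.Probability.Percolation.half).real
          {ω | ∃ u v : Literature.Probability.LatticeModels.Site 2,
              Metric.infDist (Literature.Probability.LatticeModels.meshPoint δ u) (R.arc 0)
                  ≤ Real.sqrt 2 * δ ∧
              Metric.infDist (Literature.Probability.LatticeModels.meshPoint δ v) (R.arc 2)
                  ≤ Real.sqrt 2 * δ ∧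
              u ∈ Literature.Probability.LatticeModels.meshDomain R.carrier δ ∧
              v ∈ Literature.Probability.LatticeModels.meshDomain R.carrier δ ∧
              (Literature.Probability.Percolation.openGraph ω ⊓
                Literature.Probability.LatticeModels.discreteDomainGraph R.carrier δ).Reachable u v}
          + ε := by
  sorry

/-- **Stub 3 (arc attachment).** For every conformal rectangle and `ε > 0`, eventually as
`δ → 0⁺`: the probability of an open `Ω_δ`-path between the `√2·δ`-neighbourhoods of `(ab)` and
`(cd)` exceeds G02's crossing probability `bondDomainCrossingProb R δ` (open `Ω_δ`-path between
the discrete arcs `(ab)_δ`, `(cd)_δ`) by at most `ε`. Content: attaching the ends of a crossing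
to the discrete arcs — landing within `ρ` of a marked point costs `(ρ/r)^α` (annulus circuits),
and away from the marked points boundary RSW joins the path to the discrete arc inside `Ω_δ`. -/
theorem stub_domainPath_le_discrete :
    ∀ (R : Literature.Probability.RandomPlanarGeometry.ConformalRectangle) (ε : ℝ), 0 < ε →
      ∀ᶠ δ in 𝓝[>] (0 : ℝ),
        (Literature.Probability.Percolation.bondPercolation
            (Literature.Probability.LatticeModels.zdGraph 2)
            Literature.Probability.Percolation.half).real
          {ω | ∃ u v : Literature.Probability.LatticeModels.Site 2,
              Metric.infDist (Literature.Probability.LatticeModels.meshPoint δ u) (R.arc 0)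
                  ≤ Real.sqrt 2 * δ ∧
              Metric.infDist (Literature.Probability.LatticeModels.meshPoint δ v) (R.arc 2)
                  ≤ Real.sqrt 2 * δ ∧
              u ∈ Literature.Probability.LatticeModels.meshDomain R.carrier δ ∧
              v ∈ Literature.Probability.LatticeModels.meshDomain R.carrier δ ∧
              (Literature.Probability.Percolation.openGraph ω ⊓
                Literature.Probability.LatticeModels.discreteDomainGraph R.carrier δ).Reachable u v}
          ≤ Literature.Probability.Percolation.bondDomainCrossingProb R δ + ε := by
  sorry

/-- **Assembly (real proof).** The three one-sided comparisons give the crux: reparametrise the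
crude Cardy hypothesis along `δ ↦ δ/√2` (which maps `𝓝[>] 0` to itself), then squeeze
`bondDomainCrossingProb R δ` between `crude(δ/√2) - 2ε/3` and `crude(δ/√2)`. -/
theorem DiscretisationBridge_of :
    (∀ (R : Literature.Probability.RandomPlanarGeometry.ConformalRectangle) (δ : ℝ), 0 < δ →
      Literature.Probability.Percolation.bondDomainCrossingProb R δ ≤
        (Literature.Probability.Percolation.bondPercolation
            (Literature.Probability.LatticeModels.zdGraph 2)
            Literature.Probability.Percolation.half).real
          (Literature.Probability.Percolation.embDomainCrossing
            Literature.Probability.LatticeModels.squareLatticeEmbedding.z R.carrier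
            (δ / Real.sqrt 2) (R.arc 0) (R.arc 2))) →
    (∀ (R : Literature.Probability.RandomPlanarGeometry.ConformalRectangle) (ε : ℝ), 0 < ε →
      ∀ᶠ δ in 𝓝[>] (0 : ℝ),
        (Literature.Probability.Percolation.bondPercolation
            (Literature.Probability.LatticeModels.zdGraph 2)
            Literature.Probability.Percolation.half).real
          (Literature.Probability.Percolation.embDomainCrossing
            Literature.Probability.LatticeModels.squareLatticeEmbedding.z R.carrier
            (δ / Real.sqrt 2) (R.arc 0) (R.arc 2)) ≤
        (Literature.Probability.Percolation.bondPercolation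
            (Literature.Probability.LatticeModels.zdGraph 2)
            Literature.Probability.Percolation.half).real
          {ω | ∃ u v : Literature.Probability.LatticeModels.Site 2,
              Metric.infDist (Literature.Probability.LatticeModels.meshPoint δ u) (R.arc 0)
                  ≤ Real.sqrt 2 * δ ∧
              Metric.infDist (Literature.Probability.LatticeModels.meshPoint δ v) (R.arc 2)
                  ≤ Real.sqrt 2 * δ ∧
              u ∈ Literature.Probability.LatticeModels.meshDomain R.carrier δ ∧
              v ∈ Literature.Probability.LatticeModels.meshDomain R.carrier δ ∧
              (Literature.Probability.Percolation.openGraph ω ⊓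
                Literature.Probability.LatticeModels.discreteDomainGraph R.carrier δ).Reachable u v}
          + ε) →
    (∀ (R : Literature.Probability.RandomPlanarGeometry.ConformalRectangle) (ε : ℝ), 0 < ε →
      ∀ᶠ δ in 𝓝[>] (0 : ℝ),
        (Literature.Probability.Percolation.bondPercolation
            (Literature.Probability.LatticeModels.zdGraph 2)
            Literature.Probability.Percolation.half).real
          {ω | ∃ u v : Literature.Probability.LatticeModels.Site 2,
              Metric.infDist (Literature.Probability.LatticeModels.meshPoint δ u) (R.arc 0)
                  ≤ Real.sqrt 2 * δ ∧
              Metric.infDist (Literature.Probability.LatticeModels.meshPoint δ v) (R.arc 2)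
                  ≤ Real.sqrt 2 * δ ∧
              u ∈ Literature.Probability.LatticeModels.meshDomain R.carrier δ ∧
              v ∈ Literature.Probability.LatticeModels.meshDomain R.carrier δ ∧
              (Literature.Probability.Percolation.openGraph ω ⊓
                Literature.Probability.LatticeModels.discreteDomainGraph R.carrier δ).Reachable u v}
          ≤ Literature.Probability.Percolation.bondDomainCrossingProb R δ + ε) →
    Summit.CriticalPhenomena.CardyFormulaZ2.Theses.CardyBondTriangular.DiscretisationBridge := by
  intro h₁ h₂ h₃ R hR φ x hφ
  -- the crude Cardy hypothesis, reparametrised along `δ ↦ δ/√2 : 𝓝[>] 0 → 𝓝[>] 0`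
  have hs : Tendsto (fun δ : ℝ => δ / Real.sqrt 2) (𝓝[>] (0 : ℝ)) (𝓝[>] (0 : ℝ)) := by
    refine tendsto_nhdsWithin_iff.2 ⟨?_, ?_⟩
    · have h0 : Tendsto (fun δ : ℝ => δ / Real.sqrt 2) (𝓝 (0 : ℝ)) (𝓝 (0 / Real.sqrt 2)) :=
        tendsto_id.div_const _
      rw [zero_div] at h0
      exact h0.mono_left nhdsWithin_le_nhds
    · filter_upwards [self_mem_nhdsWithin] with δ hδ
      exact div_pos hδ (Real.sqrt_pos.2 two_pos)
  have hq : Tendsto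
      (fun δ : ℝ =>
        (Literature.Probability.Percolation.bondPercolation
            (Literature.Probability.LatticeModels.zdGraph 2)
            Literature.Probability.Percolation.half).real
          (Literature.Probability.Percolation.embDomainCrossing
            Literature.Probability.LatticeModels.squareLatticeEmbedding.z R.carrier
            (δ / Real.sqrt 2) (R.arc 0) (R.arc 2)))
      (𝓝[>] (0 : ℝ))
      (𝓝 (Literature.Probability.RandomPlanarGeometry.cardyFunction
        (Literature.Probability.RandomPlanarGeometry.crossRatio x))) :=
    (hR φ x hφ).comp hs
  -- ε/3 squeeze
  rw [Metric.tendsto_nhds]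
  intro ε hε
  have hε3 : 0 < ε / 3 := by positivity
  have hA := (Metric.tendsto_nhds.1 hq) (ε / 3) hε3
  have hB := h₂ R (ε / 3) hε3
  have hC := h₃ R (ε / 3) hε3
  filter_upwards [hA, hB, hC, self_mem_nhdsWithin] with δ hqδ h2δ h3δ hδ
  have h1δ := h₁ R δ hδ
  rw [Real.dist_eq, abs_lt] at hqδ ⊢
  obtain ⟨hq1, hq2⟩ := hqδ
  constructor
  · linarith
  · linarith

/-- **Registered skeleton (checker default decl).** The shared item's decl in its primary route
file `CardyIsoradial`, concluded BY NAME with no hypotheses: `DiscretisationBridge_of` applied to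
the three (sorried) stubs; the two route decls are definitionally the same statement. -/
theorem DiscretisationBridge_proof :
    Summit.CriticalPhenomena.CardyFormulaZ2.Theses.CardyIsoradial.DiscretisationBridge :=
  DiscretisationBridge_of stub_discrete_le_crude stub_crude_le_domainPath
    stub_domainPath_le_discrete

/-- **Registered skeleton (this route's decl).** Same, for
`…Theses.CardyBondTriangular.DiscretisationBridge`. -/
theorem DiscretisationBridge_skeleton :
    Summit.CriticalPhenomena.CardyFormulaZ2.Theses.CardyBondTriangular.DiscretisationBridge :=
  DiscretisationBridge_of stub_discrete_le_crude stub_crude_le_domainPath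
    stub_domainPath_le_discrete

end Summit.CriticalPhenomena.CardyFormulaZ2.Cruxes.DiscretisationBridge.Birth
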